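import Literature.Analysis.FluidPDE.LerayHopfH1Test
import Literature.Analysis.FluidPDE.WeakSolutionWeakContinuity
import HarnessLib

/-!
# Weakly continuous weak solutions tested with `H¹_σ` fields (time-sliced form)

Analysis/FluidPDE support file in the decomposition of `Literature.Analysis.FluidPDE.galdi_energy_equality`
(Galdi 2018, Thm. 1.1), layer 1b: the energy equality of J.-L. Lions for weak solutions in
`L^∞(0,T; L²) ∩ L²(0,T; H¹) ∩ L⁴(0,T; L⁴)` (named fact `NS.lions_energy_equality_L4`,
Sohr 2001, Ch. V, Thm. 1.4.1 with (1.4.6)). Lions' doubling argument tests the weak formulation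
of `u` with (time mollifications of) `u` itself, i.e. with fields that are only in
`H¹_σ = {Ψ ∈ L², div Ψ = 0 weakly, ∇Ψ ∈ L²}`. The accepted `IsLerayHopfOn.inner_weakGrad_test_eq`
(`FluidPDE/LerayHopfH1Test`) provides exactly this for **Leray–Hopf** solutions, whose definition
carries weak `L²`-continuity in time; a very weak (distributional) solution in the sense of the
accepted `Fluid.IsWeakNSSolutionOn` does not, but once it lies in `L^∞(0,T; L²)` it has a weakly
`L²`-continuous representative (accepted `IsWeakNSSolutionOn.exists_weaklyContinuousOn_version`,
`FluidPDE/WeakSolutionWeakContinuity`, Sohr 2001, Ch. V, Thm. 1.3.1). This file proves the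
`H¹_σ` time-slice identity for such a representative:

**Main result** (`Fluid.IsWeakNSSolutionOn.inner_weakGrad_test_eq_of_continuousOn`). Let
`dim E = 3`, `u` a weak solution of the unforced system on `E × [0,T)` with datum `u₀ ∈ L²`,
`u ∈ L^∞(0,T; L²)`, every slice `u(t)`, `t ∈ [0,T]`, in `L²` and `t ↦ ⟨u(t), w⟩` continuous on
`[0,T]` for every `w ∈ L²`, `∫₀ᵀ ‖u‖₄² < ∞`, and `Gu` a jointly measurable weak-gradient witness
(a.e. in time) with `∫₀ᵀ∫|Gu|² < ∞`; let `Ψ ∈ L²` be weakly divergence free with weak gradient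
`GΨ`, `∫|GΨ|² < ∞`. Then for every `t ∈ [0, T]`
`⟨u(t), Ψ⟩ = ⟨u₀, Ψ⟩ + ∫_{(0,t]} ( ∫ ⟪GΨ u, u⟫ - ν Σᵢ ∫ ⟪Gu eᵢ, GΨ eᵢ⟫ ) ds`
(Galdi 2000, Lemma 2.1 with (2.8)/(4.3); Serrin 1963, (6); Robinson–Rodrigo–Sadowski 2016,
Lemma 8.18, density step): the every-`t` identity for smooth divergence-free tests
(accepted `IsWeakNSSolutionOn.inner_test_eq_of_continuousOn`) extended by the density of
`C_{c,σ}^∞` in `H¹_σ` (accepted `Fluid.exists_isDivFree_test_approx`, dimension `3`), with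
`ν⟨u, ΔΦₙ⟩ = -ν Σᵢ ⟨Gu eᵢ, ∂ᵢΦₙ⟩` and the error weight `∫₀ᵀ (‖u‖₄² + |ν| Σᵢ ‖Gu eᵢ‖₂) < ∞`
(`lintegral_weight_lt_top_of_L4`, `integrableOn_weakFlux_of_L4`; here the `L⁴` bound is a
hypothesis rather than the Sobolev-interpolation consequence of the Leray–Hopf class). All
proved; no new definitions.

## Mathlib / tree search

Mathlib has no weak Navier–Stokes notions; the tree has the Leray–Hopf version of the identity
(`IsLerayHopfOn.inner_weakGrad_test_eq`) and all the analytic ingredients used there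
(`enorm_weakFlux_sub_le`, `aestronglyMeasurable_weakFlux`, `exists_isDivFree_test_approx`,
`HasWeakGradient.integral_inner_laplacian_test`), which are reused verbatim.

## References

* G. P. Galdi, *An introduction to the Navier–Stokes initial-boundary value problem*, in:
  Fundamental Directions in Mathematical Fluid Mechanics, Birkhäuser 2000, Lemma 2.1, (2.8),
  Thm. 4.2 (`Galdi2000`).
* J. Serrin, *The initial value problem for the Navier–Stokes equations*, in: Nonlinear Problems
  (Madison 1962), Univ. Wisconsin Press 1963, §§3–4 (`Serrin1963`).
* J. C. Robinson, J. L. Rodrigo, W. Sadowski, *The three-dimensional Navier–Stokes equations*,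
  CUP 2016, Lemma 8.18, (8.12) (`RobinsonRodrigoSadowski2016`).
* H. Sohr, *The Navier–Stokes equations. An elementary functional analytic approach*,
  Birkhäuser 2001, Ch. V, Thm. 1.3.1, Thm. 1.4.1 (`Sohr2001`).
* G. P. Galdi, *On the energy equality for distributional solutions to Navier–Stokes equations*,
  Proc. AMS 147 (2019) 785–792, Thm. 1.1 (`Galdi2018`; the fact served).
-/

noncomputable section

open MeasureTheory TopologicalSpace Set Function Filter Topology InnerProductSpace Module
open scoped RealInnerProductSpace ENNReal NNReal Laplacian ContDiff

namespace Literature.Analysis.FluidPDE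

variable {E : Type*} [NormedAddCommGroup E] [InnerProductSpace ℝ E] [FiniteDimensional ℝ E]
  [MeasurableSpace E] [BorelSpace E]

variable {T ν : ℝ} {u₀ : E → E} {u : ℝ → E → E}

/-- The joint a.e.-measurability clause of a weak solution in product form. [folklore] -/
theorem IsWeakNSSolutionOn.aestronglyMeasurable_uncurry {f : ℝ → E → E}
    (hu : IsWeakNSSolutionOn T ν f u₀ u) :
    AEStronglyMeasurable (uncurry u) ((volume.restrict (Ioo 0 T)).prod (volume : Measure E)) := by
  rw [restrict_prod_volume_eq]; exact hu.1

/-- **The error weight** `∫₀ᵀ (‖u‖₄² + |ν| Σᵢ ‖Gu eᵢ‖₂) < ∞` for a field with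
`∫₀ᵀ ‖u‖₄² < ∞` and a jointly measurable gradient field of finite dissipation (as in the proof of
Robinson–Rodrigo–Sadowski 2016, Lemma 8.18; here the `L⁴` bound is a hypothesis rather than the
Sobolev–interpolation consequence of the Leray–Hopf class, cf. the accepted
`IsLerayHopfOn.lintegral_weight_lt_top`). [folklore] -/
theorem lintegral_weight_lt_top_of_L4
    (hum : AEStronglyMeasurable (uncurry u) ((volume.restrict (Ioo 0 T)).prod (volume : Measure E)))
    (h4 : ∫⁻ s in Ioo 0 T, eLpNorm (u s) 4 volume ^ (2 : ℝ) < ⊤)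
    {Gu : ℝ → E → E →L[ℝ] E} (hGum : StronglyMeasurable (uncurry Gu))
    (hGu₂ : ∫⁻ t in Ioo 0 T, ∫⁻ x, ENNReal.ofReal (frobeniusNormSq (Gu t x)) < ⊤) :
    ∫⁻ s in Ioo 0 T, (eLpNorm (u s) 4 volume ^ (2 : ℝ) + ENNReal.ofReal |ν| *
      ∑ i, eLpNorm (fun x => Gu s x (stdOrthonormalBasis ℝ E i)) 2 volume) < ⊤ := by
  set b := stdOrthonormalBasis ℝ E
  set D : ℝ → ℝ≥0∞ := fun s => ∫⁻ x, ENNReal.ofReal (frobeniusNormSq (Gu s x)) with hD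
  have hDm : Measurable D := measurable_lintegral_frobeniusNormSq hGum
  have hcomp : ∀ i s, eLpNorm (fun x => Gu s x (b i)) 2 volume ≤ 1 + D s := fun i s =>
    (eLpNorm_apply_le_lintegral_frobenius_rpow (Gu s) (b i) (b.orthonormal.1 i)).trans
      (ENNReal.rpow_le_one_add_self _ (by norm_num) (by norm_num))
  have hsum : ∫⁻ s in Ioo 0 T, ENNReal.ofReal |ν| * ∑ i, eLpNorm (fun x => Gu s x (b i)) 2 volume
      ≤ ENNReal.ofReal |ν| * (Fintype.card (Fin (finrank ℝ E)) *
        (volume (Ioo 0 T) + ∫⁻ s in Ioo 0 T, D s)) := by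
    calc ∫⁻ s in Ioo 0 T, ENNReal.ofReal |ν| * ∑ i, eLpNorm (fun x => Gu s x (b i)) 2 volume
        ≤ ∫⁻ s in Ioo 0 T, ENNReal.ofReal |ν| * ∑ _i : Fin (finrank ℝ E), (1 + D s) := by
          refine lintegral_mono fun s => ?_
          gcongr with i
          exact hcomp i s
      _ = ENNReal.ofReal |ν| * (Fintype.card (Fin (finrank ℝ E)) *
            (volume (Ioo 0 T) + ∫⁻ s in Ioo 0 T, D s)) := by
          simp only [Finset.sum_const, Finset.card_univ, nsmul_eq_mul]
          rw [lintegral_const_mul' _ _ ENNReal.ofReal_ne_top,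
            lintegral_const_mul' _ _ (ENNReal.natCast_ne_top _), lintegral_add_left measurable_const,
            lintegral_const, Measure.restrict_apply_univ, one_mul]
  rw [lintegral_add_left' ((FunctionSpaces.aemeasurable_eLpNorm_slice hum 4).pow_const _)]
  refine ENNReal.add_lt_top.2 ⟨h4, hsum.trans_lt ?_⟩
  refine ENNReal.mul_lt_top ENNReal.ofReal_lt_top (ENNReal.mul_lt_top (ENNReal.natCast_lt_top _)
    (ENNReal.add_lt_top.2 ⟨?_, hGu₂⟩))
  rw [Real.volume_Ioo]; exact ENNReal.ofReal_lt_top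

/-- **Integrability of the `H¹_σ` weak flux** for a weak solution with slices in `L²` a.e.,
`∫₀ᵀ ‖u‖₄² < ∞`, and a jointly measurable weak-gradient witness `Gu` of finite dissipation: for a
gradient density `A ∈ L²` (standing for `∇Ψ`), the time-sliced flux
`F(s) = ∫ ⟪A u(s), u(s)⟫ - ν Σᵢ ∫ ⟪Gu(s) eᵢ, A eᵢ⟫` is integrable on `(0, T)`
(`|F(s)| ≤ ‖A‖₂ (‖u(s)‖₄² + |ν| Σᵢ ‖Gu(s) eᵢ‖₂)`; Robinson–Rodrigo–Sadowski 2016, proof of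
Lemma 8.18). [folklore] -/
theorem integrableOn_weakFlux_of_L4
    (hum : AEStronglyMeasurable (uncurry u) ((volume.restrict (Ioo 0 T)).prod (volume : Measure E)))
    (hL2 : ∀ᵐ s ∂(volume.restrict (Ioo 0 T)), MemLp (u s) 2 volume)
    (h4 : ∫⁻ s in Ioo 0 T, eLpNorm (u s) 4 volume ^ (2 : ℝ) < ⊤)
    {Gu : ℝ → E → E →L[ℝ] E} (hGum : StronglyMeasurable (uncurry Gu))
    (hGu : ∀ᵐ t ∂(volume.restrict (Ioo 0 T)), HasWeakGradient (u t) (Gu t))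
    (hGu₂ : ∫⁻ t in Ioo 0 T, ∫⁻ x, ENNReal.ofReal (frobeniusNormSq (Gu t x)) < ⊤)
    {A : E → E →L[ℝ] E} (hA : AEStronglyMeasurable A volume)
    (hA2 : ∫⁻ x, ENNReal.ofReal (frobeniusNormSq (A x)) < ⊤) :
    IntegrableOn (fun s => (∫ x, ⟪A x (u s x), u s x⟫) -
      ν * ∑ i, ∫ x, ⟪Gu s x (stdOrthonormalBasis ℝ E i), A x (stdOrthonormalBasis ℝ E i)⟫)
      (Ioo 0 T) := by
  set b := stdOrthonormalBasis ℝ E with hb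
  set W : ℝ → ℝ≥0∞ := fun s => eLpNorm (u s) 4 volume ^ (2 : ℝ) + ENNReal.ofReal |ν| *
    ∑ i, eLpNorm (fun x => Gu s x (b i)) 2 volume with hW
  have hIW : ∫⁻ s in Ioo 0 T, W s < ⊤ := lintegral_weight_lt_top_of_L4 hum h4 hGum hGu₂
  have hDm : Measurable fun s => ∫⁻ x, ENNReal.ofReal (frobeniusNormSq (Gu s x)) :=
    measurable_lintegral_frobeniusNormSq hGum
  have hDfin : ∀ᵐ s ∂(volume.restrict (Ioo 0 T)),
      ∫⁻ x, ENNReal.ofReal (frobeniusNormSq (Gu s x)) < ⊤ := ae_lt_top hDm hGu₂.ne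
  have h4fin : ∀ᵐ s ∂(volume.restrict (Ioo 0 T)), eLpNorm (u s) 4 volume < ⊤ := by
    have h := ae_lt_top' ((FunctionSpaces.aemeasurable_eLpNorm_slice hum 4).pow_const (2 : ℝ)) h4.ne
    filter_upwards [h] with s hs
    exact (ENNReal.rpow_lt_top_iff_of_pos zero_lt_two).1 hs
  refine ⟨aestronglyMeasurable_weakFlux hA hum hGum ν, ?_⟩
  have hbound : ∀ᵐ s ∂(volume.restrict (Ioo 0 T)),
      ‖(∫ x, ⟪A x (u s x), u s x⟫) - ν * ∑ i, ∫ x, ⟪Gu s x (b i), A x (b i)⟫‖ₑ ≤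
        (∫⁻ x, ENNReal.ofReal (frobeniusNormSq (A x))) ^ (1 / 2 : ℝ) * W s := by
    filter_upwards [hGu, hL2, hDfin, h4fin] with s hGs hmem2 hDs h4s
    have hmem4 : MemLp (u s) 4 volume := ⟨hmem2.1, h4s⟩
    have hGi : ∀ i, MemLp (fun x => Gu s x (b i)) 2 volume := fun i => hGs.memLp_apply hDs i
    have h := enorm_weakFlux_sub_le hmem4 hGs.aestronglyMeasurable_deriv hGi hA
      (aestronglyMeasurable_const (b := (0 : E →L[ℝ] E))) hA2 (by simp) ν
    simpa only [Pi.zero_apply, _root_.zero_apply, inner_zero_left, inner_zero_right,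
      integral_zero, Finset.sum_const_zero, mul_zero, sub_zero] using h
  calc ∫⁻ s in Ioo 0 T, ‖(∫ x, ⟪A x (u s x), u s x⟫) - ν * ∑ i, ∫ x, ⟪Gu s x (b i), A x (b i)⟫‖ₑ
      ≤ ∫⁻ s in Ioo 0 T, (∫⁻ x, ENNReal.ofReal (frobeniusNormSq (A x))) ^ (1 / 2 : ℝ) * W s :=
        lintegral_mono_ae hbound
    _ = (∫⁻ x, ENNReal.ofReal (frobeniusNormSq (A x))) ^ (1 / 2 : ℝ) * ∫⁻ s in Ioo 0 T, W s := by
        rw [lintegral_const_mul' _ _ (ENNReal.rpow_lt_top_of_nonneg (by norm_num) hA2.ne).ne]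
    _ < ⊤ := ENNReal.mul_lt_top (ENNReal.rpow_lt_top_of_nonneg (by norm_num) hA2.ne) hIW

/-- **The `H¹_σ` time-slice identity for weakly continuous weak solutions** (Galdi 2000,
Lemma 2.1 with (2.8)/(4.3); Serrin 1963, (6); Robinson–Rodrigo–Sadowski 2016, Lemma 8.18, density
step). Let `u` be a weak solution of the unforced Navier–Stokes system on `E × [0,T)`, `T > 0`,
with datum `u₀ ∈ L²`, lying in `L^∞(0,T; L²)`, every slice `u(t)`, `t ∈ [0,T]`, in `L²`,
weakly `L²`-continuous on `[0, T]` (`t ↦ ∫⟪u(t), w⟫` continuous for every `w ∈ L²`, as supplied by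
`IsWeakNSSolutionOn.exists_weaklyContinuousOn_version`), with `∫₀ᵀ ‖u‖₄² < ∞` and a jointly
measurable weak-gradient witness `Gu` (a.e. in time), `∫₀ᵀ∫|Gu|² < ∞`. Let `Ψ ∈ L²` be weakly
divergence free with weak gradient `GΨ`, `∫|GΨ|² < ∞`. Then for every `t ∈ [0, T]`
`⟨u(t), Ψ⟩ = ⟨u₀, Ψ⟩ + ∫_{(0,t]} ( ∫ ⟪GΨ u, u⟫ - ν Σᵢ ∫ ⟪Gu eᵢ, GΨ eᵢ⟫ ) ds`.
Proof as the accepted `IsLerayHopfOn.inner_weakGrad_test_eq`: approximate `Ψ` in `H¹` by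
divergence-free test fields (`exists_isDivFree_test_approx`, dimension `3`), apply the every-`t`
identity for test fields (`IsWeakNSSolutionOn.inner_test_eq_of_continuousOn`), rewrite
`ν⟨u, ΔΦₙ⟩ = -ν Σᵢ ⟨Gu eᵢ, ∂ᵢΦₙ⟩` and pass to the limit with the weight
`∫₀ᵀ(‖u‖₄² + |ν|Σ‖Gu eᵢ‖₂) < ∞`. [cite: Galdi2000, Lemma 2.1] -/
theorem IsWeakNSSolutionOn.inner_weakGrad_test_eq_of_continuousOn (hE3 : finrank ℝ E = 3)
    (hu : IsWeakNSSolutionOn T ν 0 u₀ u) (hT : 0 < T) (hE : MemLqLp ∞ 2 u (Ioo 0 T))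
    (hL2 : ∀ t ∈ Icc 0 T, MemLp (u t) 2 volume)
    (hcont : ∀ w : E → E, MemLp w 2 volume → ContinuousOn (fun t => ∫ x, ⟪u t x, w x⟫) (Icc 0 T))
    (hu₀ : MemLp u₀ 2 volume)
    (h4 : ∫⁻ s in Ioo 0 T, eLpNorm (u s) 4 volume ^ (2 : ℝ) < ⊤)
    {Gu : ℝ → E → E →L[ℝ] E}
    (hGum : StronglyMeasurable (uncurry Gu))
    (hGu : ∀ᵐ t ∂(volume.restrict (Ioo 0 T)), HasWeakGradient (u t) (Gu t))
    (hGu₂ : ∫⁻ t in Ioo 0 T, ∫⁻ x, ENNReal.ofReal (frobeniusNormSq (Gu t x)) < ⊤)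
    {Ψ : E → E} {GΨ : E → E →L[ℝ] E} (hΨ2 : MemLp Ψ 2 volume) (hΨdiv : IsWeaklyDivFree Ψ)
    (hΨG : HasWeakGradient Ψ GΨ) (hGΨ2 : ∫⁻ x, ENNReal.ofReal (frobeniusNormSq (GΨ x)) < ⊤)
    {t : ℝ} (ht : t ∈ Icc 0 T) :
    ∫ x, ⟪u t x, Ψ x⟫ = (∫ x, ⟪u₀ x, Ψ x⟫) +
      ∫ s in Ioc 0 t, ((∫ x, ⟪GΨ x (u s x), u s x⟫) -
        ν * ∑ i, ∫ x, ⟪Gu s x (stdOrthonormalBasis ℝ E i), GΨ x (stdOrthonormalBasis ℝ E i)⟫) := by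
  set b := stdOrthonormalBasis ℝ E with hb
  haveI : ENNReal.HolderTriple 4 4 2 := holderTriple_four_four_two
  have hb1 : ∀ i, ‖b i‖ = 1 := fun i => b.orthonormal.1 i
  have hGΨm : AEStronglyMeasurable GΨ volume := hΨG.aestronglyMeasurable_deriv
  have hum := hu.aestronglyMeasurable_uncurry
  have hL2ae : ∀ᵐ s ∂(volume.restrict (Ioo 0 T)), MemLp (u s) 2 volume :=
    hE.ae_memLp_and_kineticEnergy_le.mono fun s hs => hs.1
  -- ### the approximating test fields
  set δ : ℕ → ℝ≥0∞ := fun n => ((n + 1 : ℕ) : ℝ≥0∞)⁻¹ with hδdef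
  have hδpos : ∀ n, 0 < δ n := fun n => ENNReal.inv_pos.2 (ENNReal.natCast_ne_top _)
  have hδlim : Tendsto δ atTop (𝓝 0) :=
    ENNReal.tendsto_inv_nat_nhds_zero.comp (tendsto_add_atTop_nat 1)
  have hδlim' : Tendsto (fun n => δ n ^ (1 / 2 : ℝ)) atTop (𝓝 0) := by
    have := ((ENNReal.continuous_rpow_const (y := 1 / 2)).tendsto (0 : ℝ≥0∞)).comp hδlim
    rwa [ENNReal.zero_rpow_of_pos (by norm_num)] at this
  choose Φ hΦtest hΦdiv hΦL2 hΦH1 using fun n : ℕ =>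
    exists_isDivFree_test_approx hE3 hΨ2 hΨdiv hΨG hGΨ2 (hδpos n)
  have hΦD : ∀ n, AEStronglyMeasurable (fderiv ℝ (Φ n)) volume := fun n =>
    ((hΦtest n).contDiff.continuous_fderiv (by simp)).aestronglyMeasurable
  have hΦDfin : ∀ n, ∫⁻ x, ENNReal.ofReal (frobeniusNormSq (fderiv ℝ (Φ n) x)) < ⊤ := by
    intro n
    have hc : Continuous (frobeniusNormSq ∘ fderiv ℝ (Φ n)) :=
      NSWeakStrongUniqueness.continuous_frobeniusNormSq.comp ((hΦtest n).contDiff.continuous_fderiv (by simp))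
    have hK : HasCompactSupport (frobeniusNormSq ∘ fderiv ℝ (Φ n)) :=
      ((hΦtest n).hasCompactSupport.fderiv ℝ).comp_left frobeniusNormSq_zero
    have hi : Integrable (frobeniusNormSq ∘ fderiv ℝ (Φ n)) volume :=
      hc.integrable_of_hasCompactSupport hK
    have h2 : ∫⁻ x, ‖(frobeniusNormSq ∘ fderiv ℝ (Φ n)) x‖ₑ < ⊤ := hi.2
    refine lt_of_le_of_lt (lintegral_mono fun x => ?_) h2
    exact Real.ofReal_le_enorm _
  -- ### notation: fluxes and the weight
  set FΦ : ℕ → ℝ → ℝ := fun n s =>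
    ∫ x, (⟪u s x, convect (u s) (Φ n) x⟫ + ν * ⟪u s x, (Δ (Φ n)) x⟫) with hFΦ
  set F : ℝ → ℝ := fun s => (∫ x, ⟪GΨ x (u s x), u s x⟫) -
    ν * ∑ i, ∫ x, ⟪Gu s x (b i), GΨ x (b i)⟫ with hF
  set W : ℝ → ℝ≥0∞ := fun s => eLpNorm (u s) 4 volume ^ (2 : ℝ) + ENNReal.ofReal |ν| *
    ∑ i, eLpNorm (fun x => Gu s x (b i)) 2 volume with hW
  have hIW : ∫⁻ s, W s ∂(volume.restrict (Ioo 0 T)) < ⊤ :=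
    lintegral_weight_lt_top_of_L4 hum h4 hGum hGu₂
  -- the identities for the test fields, at every `t ∈ [0, T]`
  have hI : ∀ n, ∫ x, ⟪u t x, Φ n x⟫ = (∫ x, ⟪u₀ x, Φ n x⟫) + ∫ s in Ioc 0 t, FΦ n s :=
    fun n => by
      rw [hFΦ]
      exact hu.inner_test_eq_of_continuousOn hT hE (hΦtest n) (hΦdiv n)
        (hcont (Φ n) ((hΦtest n).memLp_volume 2)) ht
  -- ### the pointwise error bound for a.e. `s`
  set D : ℝ → ℝ≥0∞ := fun s => ∫⁻ x, ENNReal.ofReal (frobeniusNormSq (Gu s x)) with hD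
  have hDm : Measurable D := measurable_lintegral_frobeniusNormSq hGum
  have hDfin : ∀ᵐ s ∂(volume.restrict (Ioo 0 T)), D s < ⊤ := ae_lt_top hDm hGu₂.ne
  have h4fin : ∀ᵐ s ∂(volume.restrict (Ioo 0 T)), eLpNorm (u s) 4 volume < ⊤ := by
    have h := ae_lt_top' ((FunctionSpaces.aemeasurable_eLpNorm_slice hum 4).pow_const (2 : ℝ)) h4.ne
    filter_upwards [h] with s hs
    exact (ENNReal.rpow_lt_top_iff_of_pos zero_lt_two).1 hs
  have hgood : ∀ᵐ s ∂(volume.restrict (Ioo 0 T)), ∀ n,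
      ‖FΦ n s - F s‖ₑ ≤ δ n ^ (1 / 2 : ℝ) * W s := by
    filter_upwards [hGu, hL2ae, hDfin, h4fin] with s hGs hmem2 hDs h4s
    intro n
    have hmem4 : MemLp (u s) 4 volume := ⟨hmem2.1, h4s⟩
    -- rewrite the smooth flux in gradient form
    have i1 : Integrable (fun x => ⟪u s x, convect (u s) (Φ n) x⟫) volume :=
      integrable_inner_fderiv_apply_of_memLp_two hmem2 hmem2 (hΦtest n)
    have i2 : Integrable (fun x => ⟪u s x, (Δ (Φ n)) x⟫) volume :=
      integrable_inner_of_memLp_two hmem2 ((hΦtest n).memLp_laplacian 2)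
    have hflux : FΦ n s = (∫ x, ⟪fderiv ℝ (Φ n) x (u s x), u s x⟫) -
        ν * ∑ i, ∫ x, ⟪Gu s x (b i), fderiv ℝ (Φ n) x (b i)⟫ := by
      simp only [hFΦ]
      rw [integral_add i1 (i2.const_mul ν), MeasureTheory.integral_const_mul,
        hGs.integral_inner_laplacian_test (hΦtest n)]
      have : ∫ x, ⟪u s x, convect (u s) (Φ n) x⟫ = ∫ x, ⟪fderiv ℝ (Φ n) x (u s x), u s x⟫ :=
        integral_congr_ae (ae_of_all _ fun x => by dsimp only; rw [convect_apply, real_inner_comm])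
      rw [this]; ring
    rw [hflux]
    have hGi : ∀ i, MemLp (fun x => Gu s x (b i)) 2 volume := fun i => hGs.memLp_apply hDs i
    refine (enorm_weakFlux_sub_le hmem4 hGs.aestronglyMeasurable_deriv hGi (hΦD n) hGΨm
      (hΦDfin n) hGΨ2 ν).trans ?_
    exact mul_le_mul' (ENNReal.rpow_le_rpow (hΦH1 n) (by norm_num)) le_rfl
  -- ### integrability of the fluxes on `(0, T)`
  have hWm : AEMeasurable W (volume.restrict (Ioo 0 T)) := by
    refine ((FunctionSpaces.aemeasurable_eLpNorm_slice hum 4).pow_const _).add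
      (AEMeasurable.const_mul (Finset.aemeasurable_fun_sum _ fun i _ => ?_) _)
    exact (FunctionSpaces.measurable_eLpNorm_slice (g := fun s x => Gu s x (b i))
      ((ContinuousLinearMap.apply ℝ E (b i)).continuous.comp_stronglyMeasurable hGum) 2).aemeasurable
  have hFΦint : ∀ n, IntegrableOn (FΦ n) (Ioo 0 T) := fun n => by
    rw [hFΦ]; exact hu.integrableOn_flux_of_memLqLp hE (hΦtest n)
  have hFint : IntegrableOn F (Ioo 0 T) :=
    integrableOn_weakFlux_of_L4 hum hL2ae h4 hGum hGu hGu₂ hGΨm hGΨ2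
  -- ### integrability on `(0, t]`
  have hsub : Ioo 0 t ⊆ Ioo 0 T := Ioo_subset_Ioo le_rfl ht.2
  have hFΦt : ∀ n, IntegrableOn (FΦ n) (Ioc 0 t) := fun n =>
    (integrableOn_Ioc_iff_integrableOn_Ioo (hb := enorm_ne_top)).2 ((hFΦint n).mono_set hsub)
  have hFt : IntegrableOn F (Ioc 0 t) :=
    (integrableOn_Ioc_iff_integrableOn_Ioo (hb := enorm_ne_top)).2 (hFint.mono_set hsub)
  -- ### limit of the flux integrals
  have hflux_lim : Tendsto (fun n => ∫ s in Ioc 0 t, FΦ n s) atTop (𝓝 (∫ s in Ioc 0 t, F s)) := by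
    refine tendsto_of_enorm_sub_le
      (e := fun n => δ n ^ (1 / 2 : ℝ) * ∫⁻ s, W s ∂(volume.restrict (Ioo 0 T)))
      (fun n => ?_) ?_
    · rw [← integral_sub (hFΦt n) hFt]
      calc ‖∫ s in Ioc 0 t, (FΦ n s - F s)‖ₑ ≤ ∫⁻ s in Ioc 0 t, ‖FΦ n s - F s‖ₑ :=
            enorm_integral_le_lintegral_enorm _
        _ = ∫⁻ s in Ioo 0 t, ‖FΦ n s - F s‖ₑ := setLIntegral_congr Ioo_ae_eq_Ioc.symm
        _ ≤ ∫⁻ s in Ioo 0 T, ‖FΦ n s - F s‖ₑ := lintegral_mono_set hsub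
        _ ≤ ∫⁻ s in Ioo 0 T, δ n ^ (1 / 2 : ℝ) * W s :=
            lintegral_mono_ae (hgood.mono fun s hs => hs n)
        _ = δ n ^ (1 / 2 : ℝ) * ∫⁻ s, W s ∂(volume.restrict (Ioo 0 T)) :=
            lintegral_const_mul'' _ hWm
    · have h := ENNReal.Tendsto.mul_const hδlim' (Or.inr hIW.ne)
      rwa [zero_mul] at h
  -- ### limits of the pairings
  have hpair : ∀ {v : E → E}, MemLp v 2 volume →
      Tendsto (fun n => ∫ x, ⟪v x, Φ n x⟫) atTop (𝓝 (∫ x, ⟪v x, Ψ x⟫)) := by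
    intro v hv
    refine tendsto_of_enorm_sub_le (e := fun n => eLpNorm v 2 volume * δ n) (fun n => ?_) ?_
    · rw [← integral_sub (integrable_inner_of_memLp_two hv ((hΦtest n).memLp_volume 2))
        (integrable_inner_of_memLp_two hv hΨ2)]
      have : (fun x => ⟪v x, Φ n x⟫ - ⟪v x, Ψ x⟫) = fun x => ⟪v x, (Φ n - Ψ) x⟫ := by
        ext x; rw [Pi.sub_apply, inner_sub_right]
      rw [this]
      exact (FunctionSpaces.enorm_integral_inner_le_eLpNorm_mul hv.1
        (((hΦtest n).memLp_volume 2).sub hΨ2).1).trans (mul_le_mul' le_rfl (hΦL2 n))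
    · have h := ENNReal.Tendsto.const_mul hδlim (Or.inr hv.eLpNorm_ne_top)
      rwa [mul_zero] at h
  have hL := hpair (hL2 t ht)
  have hR := (hpair hu₀).add hflux_lim
  have hLR : (fun n => ∫ x, ⟪u t x, Φ n x⟫) =
      fun n => (∫ x, ⟪u₀ x, Φ n x⟫) + ∫ s in Ioc 0 t, FΦ n s := funext hI
  rw [hLR] at hL
  exact tendsto_nhds_unique hL hR

end Literature.Analysis.FluidPDE
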